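import Literature.MathematicalPhysics.QuantumFieldTheory.Balaban1983to89.B9Eq3132FlatReadingAtOne

/-!
# `Balaban1983to89.B9Eq3132NuReading` — T. Bałaban, *Propagators for lattice gauge theories in a background field*, Commun. Math. Phys. **99** (1985)
# 389–434 [Balaban1985BackgroundPropagators], (3.132) p. 422: THE REPAIRED READING OF ROW 26 — the `ν`-WEIGHTED site kernel of `(QGQ*)⁻¹`,
# the Λ-NORMALISED Combes–Thomas face, row 26 re-derived on it, and the instance variant `opsYNuOfLetters`

statement-level skeleton of published theorems with citation tags; proofs where landed; nothing here is a claim about the Yang–Mills mass gap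

WHY THIS FILE.  `B9Eq3132FlatReadingAtOne ∕ …AtRecord` (n06-i g7, p506123): (3.132) as typed is FALSE for def-Y's FLAT reading of the genuine `(QGQ*)⁻¹` (flat
entries `≍ Λ_y⁻¹Λ_{y′}⁻¹` by [4] (2.142)∕(2.149)), and the estimate binders of the landed Combes–Thomas face (weights `(Lʲη)^{−(1+d′∕2)}`) are jointly unsatisfiable.
THE REPAIR, both halves: (R1) READ `(QGQ*)⁻¹`, `(QG₁Q*)⁻¹` through the product weight `ν(y)ν(y′)`, `ν(y) := (Lʲη)^{−(1+d″∕2)}·Λ_y` (`Λ_y² = B6Prop27KLevelV1.wt`;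
for members `ν = η^{D∕2}(Lʲη)^{−D}` at `d″ = D`); (R2) NORMALISE the Combes–Thomas matrix by `Λ⁻¹` ([4]'s conjugation `Λ⁻¹(QGQ*)Λ⁻¹`, p. 248,
`B6Prop27KLevelV1.Tc`).  Then `ν·Λ⁻¹ = (Lʲη)^{−(1+d″∕2)}` EXACTLY, so n06-i g3's scalar-index pipeline applies UNCHANGED, and at `U = 1` BOTH binders are [4]-TRUE
((2.147) `B6QGQCoerciveKLevelV1.qgq_coercive_kLevel`, (2.142) `B6Ineq2142KLevelV1.ineq2142_kLevel`) and the repaired row is a THEOREM there (sibling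
`B9Eq3132NuReadingAtOne`, from `prop27_kLevel_unconditional`).

## WHAT IS PROVED ∕ DEFINED (sorry-free, standard axioms)

* §1 `siteKernelOfOpNu i B cfg ν O` — `kerν U y y′ := ν(y)ν(y′)·sup_{‖E‖≤1}‖(O U)(δ_{y′}⊗E)(y)‖` (def-Y's `siteKernelOfOp … id id` times the weight);
  `siteKernelOfOpNu_ker` (`rfl`), `siteKernelOfOpNu_ker_nonneg`.
* §2 `lamY i y := B6Prop27KLevelV1.lam …` (`Λ_y`), `lamInvY` (`Λ_y⁻¹`, the normalisation), ★ `nuY dd i y := (Lʲη)^{−(1+dd∕2)}·Λ_y`; positivity;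
  ★ `nuY_mul_lamInvY : ν·Λ⁻¹ = (Lʲη)^{−(1+dd∕2)}`.
* §3 `invNormalisedIdx_nu_of_ringInverse` — g4's inverse-normalised dictionary for `U ↦ Ring.inverse (T U)` carries over to the `ν`-reading with weights `ν·w`.
* §4 ★★ `stmt3132Printed_nu_of_coercive_decay` — `B9.Stmt3132Printed dd c35 geo9Y (bg9Y 𝔸 G) (ν-reading of Ring.inverse∘T) (ν-reading of Ring.inverse∘T₁)` from
  `CoerciveUnder ∕ DecayUnder` of `normMatY b Λ⁻¹ (T x U)` and of `normMatY b Λ⁻¹ (T₁ x U)` (any finite-dimensional `𝔸` with a real basis `b`, any `G`).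
* §6 `operatorLayerYS349Nu`, `opsYS349NuOfLetters`, ★★ `opsYNuOfRecordV4E N θ M⋆ 𝔯 𝔢 𝔴 𝔈` = def-Y's instance of record `opsYOfRecordV4E` (p500763) with
  ONLY the two (3.132) fields `ν`-read (`opsYNuOfRecordV4E_QGQinv ∕ _QG1Qinv`, ★ `opsYNuOfRecordV4E_letters ∕ _sectE ∕ _preds`: the 21 other fields `rfl`-equal — rows 1–25 of a
  certificate at `opsYOfRecordV4E` transport verbatim), ★★★ `s3132Nu_opsYNuOfRecordV4E … b hco hdec hco₁ hdec₁` = the knit's row-26 face at the repaired instance.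
* §5 ★ `operatorLayerYNu 𝔸 G x 𝔏 𝔈` ∕ `opsYNuOfLetters N θ M⋆ 𝔏 𝔈` — def-Y's `operatorLayerYOfLetters ∕ opsYOfLetters` with ONLY the two row-26 fields re-read
  through `nuY (d+1)` (`operatorLayerYNu_fields`, `rfl`).

CONSUMER NOTE (node00-def-Y ∕ dag-n06-d).  Knit at `opsYNuOfRecordV4E` (§6): rows 1–25 transport from `opsYOfRecordV4E` by `opsYNuOfRecordV4E_letters ∕ _sectE ∕ _preds`,
row 26 = `s3132Nu_opsYNuOfRecordV4E`.  Any def-Y weight `ν′` with `ν′·Λ⁻¹ = (Lʲη)^{−(1+dd∕2)}` up to a (2.60)-admissible factor serves §4 verbatim.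

HONEST SCOPE.  Definitions + one composition of landed theorems; the four Λ-normalised estimates at `U ≠ 1` are [B9]'s content (Thm 3.12's prefix:
«G has all the properties formulated in Theorems 3.3, 3.10, 3.11», p. 420; «(QGQ*)⁻¹ … analyzed in the same way as (Q′G′²Q′*)⁻¹», p. 422) and stay
HYPOTHESES — but now hypotheses that HOLD at `U = 1` (sibling file).  COUNT-NEUTRAL; N06 NOT discharged; one finite 𝕋^{d+1} programme — nothing continuum ∕
OS ∕ mass-gap ∕ Clay.  Cell `pub-ymgap` (D-0062), node N06 [B9], seat `pub-ymgap-dag-n06-i` (bundle F4; gen 7), 2026-08-27.  A NEW file.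
-/

namespace Literature.MathematicalPhysics.QuantumFieldTheory.Balaban1983to89.B9Eq3132NuReading

open Node00
open scoped InnerProductSpace
open B6KLevelCensusIndexV1 (KIdx)
open B6SectAOperatorsV1 (BondIdx BondIdxSpace)
open B6SectAVectorModelV1 (EE)
open B6Ineq2142KLevelV1 (lvl β)
open B6Prop27KLevelV1 (wt wt_pos lam lam_pos lam_sq)
open B6GlobalChartV1 (PV domT)
open B6MultiLevelBoxOperator (N0)
open B6MultiLevelTorusOperator (TDomains)
open B6Ineq2133TwoScaleV1 (onFun onFun_apply)
open B9PinMembersKLevelV1 (MemberY geo9Y bg9Y)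
open B9Eq3132CTInputs (CoerciveUnder DecayUnder)
open B9Eq3132ScalarIndex (geoComap InvNormalisedIdx stmt3132Printed_geo9Y_of_coercive_decay_idx)
open B9Eq3132RingInverseReading (normMatY invNormalisedIdx_of_ringInverse siteKernelOfOp_ker_nonneg)
open B9GeoLemma21KLevelV1 (geo9Y_len_pos weightsTransfer_symm_geo9Y symmA_pos)

noncomputable section

variable {𝔸 : Type} [NormedRing 𝔸] [NormedAlgebra ℂ 𝔸] [CompleteSpace 𝔸]
variable {d ℓ : ℕ} {hd : 1 ≤ d + 1} {hL : Odd (ℓ + 1) ∧ 1 < ℓ + 1} {b₀ b₁ : ℝ} {Mstar : ℕ}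

/-! ## §1 The `ν`-weighted reading of a coarse-bond letter -/

section Reading

/-- **THE `ν`-WEIGHTED SITE-KERNEL READING** of a letter `O(U)` on coarse-bond functions: `kerν U y y′ := ν(y)·ν(y′)·sup_{‖E‖ ≤ 1} ‖(O U)(δ_{y′} ⊗ E)(y)‖`
(def-Y's flat `siteKernelOfOp … id id` times a product weight; with `ν := nuY` it converts r03's∕def-Y's flat entries of `(QGQ*)⁻¹` to the units of (3.132)).
[cite: Balaban1985BackgroundPropagators, (3.132) p.422; Balaban1984PropagatorsII, (2.149) p.249] -/
def siteKernelOfOpNu (i : KIdx d ℓ hd hL b₀ b₁) (B : B9.Backgrounds) (cfg : B.Cfg → CfgY 𝔸 i) (ν : IBondY i → ℝ)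
    (O : CfgY 𝔸 i → (IBondY i → 𝔸) →ₗ[ℂ] (IBondY i → 𝔸)) : B9.SiteKernel (B9GeoNormsKLevelV1.geo9K i) B :=
  ⟨fun U b b' => ν b * ν b' * (siteKernelOfOp i B cfg O id id).ker U b b'⟩

variable (i : KIdx d ℓ hd hL b₀ b₁) (B : B9.Backgrounds) (cfg : B.Cfg → CfgY 𝔸 i) (ν : IBondY i → ℝ)
  (O : CfgY 𝔸 i → (IBondY i → 𝔸) →ₗ[ℂ] (IBondY i → 𝔸))

/-- unfolding: the weighted reading is `ν(b)ν(b′)` times the flat one. [cite: Balaban1985BackgroundPropagators, (3.132) p.422, bookkeeping] -/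
theorem siteKernelOfOpNu_ker (U : B.Cfg) (b b' : IBondY i) :
    (siteKernelOfOpNu i B cfg ν O).ker U b b' = ν b * ν b' * (siteKernelOfOp i B cfg O id id).ker U b b' := rfl

/-- the weighted reading is non-negative for non-negative weights. [cite: Balaban1985BackgroundPropagators, (3.132) p.422, bookkeeping] -/
theorem siteKernelOfOpNu_ker_nonneg (hν : ∀ y, 0 ≤ ν y) (U : B.Cfg) (b b' : IBondY i) : 0 ≤ (siteKernelOfOpNu i B cfg ν O).ker U b b' :=
  mul_nonneg (mul_nonneg (hν b) (hν b')) (siteKernelOfOp_ker_nonneg i B cfg O id id U b b')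

end Reading

/-! ## §2 The canonical weight `ν(y) = (Lʲη)^{−(1+d″∕2)}·Λ_y` and the normalisation `Λ⁻¹` at an index -/

section Weights

variable (dd : ℕ) (i : KIdx d ℓ hd hL b₀ b₁)

/-- **[4]'s `Λ_y`** at an index (`Λ_y² = B6Prop27KLevelV1.wt = (Lʲ∕c_f)²·L^{−jD}`, the size of the flat diagonal of `QGQ*`, (2.142)).
[cite: Balaban1984PropagatorsII, (2.142) p.248, (2.81) p.237] -/
def lamY (y : IBondY i) : ℝ := lam i.hN i.D i.hk i.cf y

/-- `Λ_y > 0`. [cite: Balaban1984PropagatorsII, (2.81) p.237, bookkeeping] -/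
theorem lamY_pos (y : IBondY i) : 0 < lamY i y := lam_pos i.hN i.D i.hk i.hcf y
/-- **THE NORMALISATION WEIGHT `Λ_y⁻¹`** of the repaired Combes–Thomas face ([4]'s conjugation `Λ⁻¹(QGQ*)Λ⁻¹`, `B6Prop27KLevelV1.Tc`).
[cite: Balaban1984PropagatorsII, (2.81) p.237, (2.147) p.248] -/
def lamInvY (y : IBondY i) : ℝ := (lamY i y)⁻¹

/-- `Λ_y⁻¹ > 0`. [cite: Balaban1984PropagatorsII, (2.81) p.237, bookkeeping] -/
theorem lamInvY_pos (y : IBondY i) : 0 < lamInvY i y := inv_pos.2 (lamY_pos i y)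
/-- **THE CANONICAL READING WEIGHT `ν(y) := (Lʲη)^{−(1+d″∕2)}·Λ_y`** (`d″` = the bundle's dimension exponent `dd`; for members `c_f = Lᵏ` and `dd = D`:
`ν(y) = η^{D∕2}(Lʲη)^{−D}`), chosen so that `ν·Λ⁻¹ = (Lʲη)^{−(1+d″∕2)}` — the symmetric weights of the N06 row-26 pipeline.
[cite: Balaban1985BackgroundPropagators, (3.132) p.422; Balaban1984PropagatorsII, (2.149) p.249, Lemma 2.1 (2.60) p.234] -/
def nuY (y : IBondY i) : ℝ := (B9GeoNormsKLevelV1.geo9K i).len y ^ (-(1 + (dd : ℝ) / 2)) * lamY i y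

/-- `ν(y) > 0`. [cite: Balaban1985BackgroundPropagators, (3.132) p.422, bookkeeping] -/
theorem nuY_pos (y : IBondY i) : 0 < nuY dd i y := mul_pos (Real.rpow_pos_of_pos (B6KLevelCensusIndexV1.len_pos i y) _) (lamY_pos i y)
/-- `ν(y)·Λ_y⁻¹ = (Lʲη)^{−(1+d″∕2)}`. [cite: Balaban1984PropagatorsII, (2.81) p.237, bookkeeping] -/
theorem nuY_mul_lamInvY (y : IBondY i) : nuY dd i y * lamInvY i y = (B9GeoNormsKLevelV1.geo9K i).len y ^ (-(1 + (dd : ℝ) / 2)) := by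
  rw [nuY, lamInvY, mul_assoc, mul_inv_cancel₀ (lamY_pos i y).ne', mul_one]

end Weights

/-! ## §3 The dictionary for the weighted reading of a ring-inverse letter -/

section Dictionary

variable {Ff : Type} [Fintype Ff] [DecidableEq Ff] (b : Module.Basis Ff ℝ 𝔸)

/-- **THE INVERSE-NORMALISED DICTIONARY FOR THE `ν`-READING** of `U ↦ Ring.inverse (T U)` (`w > 0`, `ν ≥ 0`): blockwise domination by
`(νw)(y)(νw)(y′)·Σ|S(U)⁻¹ab|`, `S(U) = normMatY b w (T U)` (g4's `invNormalisedIdx_of_ringInverse` × `ν(y)ν(y′)`). [cite: Balaban1985BackgroundPropagators, (3.132) p.422 (dictionary)] -/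
theorem invNormalisedIdx_nu_of_ringInverse (i : KIdx d ℓ hd hL b₀ b₁) (B : B9.Backgrounds) (cfg : B.Cfg → CfgY 𝔸 i)
    [instF : Fintype (B9GeoNormsKLevelV1.geo9K i).Site] [instD : DecidableEq (B9GeoNormsKLevelV1.geo9K i).Site]
    (T : CfgY 𝔸 i → Module.End ℂ ((B9GeoNormsKLevelV1.geo9K i).Site → 𝔸)) {w ν : (B9GeoNormsKLevelV1.geo9K i).Site → ℝ}
    (hw : ∀ y, 0 < w y) (hν : ∀ y, 0 ≤ ν y) :
    InvNormalisedIdx (siteKernelOfOpNu i B cfg ν (fun V => Ring.inverse (T V)))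
      (Prod.fst : (B9GeoNormsKLevelV1.geo9K i).Site × Ff → (B9GeoNormsKLevelV1.geo9K i).Site)
      (fun U => normMatY b w (T (cfg U))) (fun y => ν y * w y) := by
  intro U y y'
  have h := invNormalisedIdx_of_ringInverse b i B cfg (instF := instF) (instD := instD) T hw U y y'
  have hk0 := siteKernelOfOp_ker_nonneg i B cfg (fun V => Ring.inverse (T V)) id id U y y'
  have hflat : (siteKernelOfOp i B cfg (fun V => Ring.inverse (T V)) id id).ker U y y' ≤
      w y * w y' * ∑ a ∈ Finset.univ.filter (fun a : (B9GeoNormsKLevelV1.geo9K i).Site × Ff => a.1 = y),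
          ∑ c ∈ Finset.univ.filter (fun c : (B9GeoNormsKLevelV1.geo9K i).Site × Ff => c.1 = y'), |(normMatY b w (T (cfg U)))⁻¹ a c| :=
    (le_abs_self _).trans h
  show |ν y * ν y' * (siteKernelOfOp i B cfg (fun V => Ring.inverse (T V)) id id).ker U y y'| ≤
      ν y * w y * (ν y' * w y') * ∑ a ∈ Finset.univ.filter (fun a : (B9GeoNormsKLevelV1.geo9K i).Site × Ff => a.1 = y),
          ∑ c ∈ Finset.univ.filter (fun c : (B9GeoNormsKLevelV1.geo9K i).Site × Ff => c.1 = y'), |(normMatY b w (T (cfg U)))⁻¹ a c|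
  refine (abs_of_nonneg (mul_nonneg (mul_nonneg (hν y) (hν y')) hk0)).trans_le ?_
  calc ν y * ν y' * (siteKernelOfOp i B cfg (fun V => Ring.inverse (T V)) id id).ker U y y'
      ≤ ν y * ν y' * (w y * w y' * ∑ a ∈ Finset.univ.filter (fun a : (B9GeoNormsKLevelV1.geo9K i).Site × Ff => a.1 = y),
          ∑ c ∈ Finset.univ.filter (fun c : (B9GeoNormsKLevelV1.geo9K i).Site × Ff => c.1 = y'), |(normMatY b w (T (cfg U)))⁻¹ a c|) :=
        mul_le_mul_of_nonneg_left hflat (mul_nonneg (hν y) (hν y'))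
    _ = _ := by ring

end Dictionary

/-! ## §4 ★ Row 26 FOR THE `ν`-READING from the Λ-normalised Combes–Thomas binders -/

section Row26

variable (G : Subgroup 𝔸ˣ) {Ff : Type} [Fintype Ff] [DecidableEq Ff] (b : Module.Basis Ff ℝ 𝔸)

omit [DecidableEq Ff] in
/-- the fibres of `Prod.fst` have `card Ff` elements. [folklore] -/
private theorem card_fiber_fst {X : Type} [Fintype X] [DecidableEq X] (y : X) :
    (Finset.univ.filter fun a : X × Ff => a.1 = y).card = Fintype.card Ff := by
  rw [show (Finset.univ.filter fun a : X × Ff => a.1 = y) = ({y} : Finset X) ×ˢ (Finset.univ : Finset Ff) by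
    ext ⟨a, f⟩
    simp [eq_comm]]
  simp

/-- ★ **ROW 26 (`B9.Stmt3132Printed`) FOR THE `ν`-READINGS OF TWO RING-INVERSE LETTERS FROM THE Λ-NORMALISED BINDERS** (coercivity ∕ decay of
`normMatY b Λ⁻¹ (T U)` — [4]'s conjugation in the real product basis; [B9] Thm 3.11-∕3.3-type hypotheses at `U ≠ 1`), through n06-i g3's scalar-index
Combes–Thomas pipeline UNCHANGED (`ν·Λ⁻¹ = (Lʲη)^{−(1+d″∕2)}`; [4] Lemma 2.1 (2.60)–(2.61) by name).
[cite: Balaban1985BackgroundPropagators, (3.132) p.422, Thm 3.12 p.423 (prefix); Balaban1984PropagatorsII, (2.81) p.237, Prop. 2.7 (2.149) p.249, Lemma 2.1 (2.60)–(2.61) p.234] -/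
theorem stmt3132Printed_nu_of_coercive_decay (dd : ℕ) [∀ x : MemberY d ℓ hd hL b₀ b₁ Mstar, Fintype (geo9Y x).Site]
    [∀ x : MemberY d ℓ hd hL b₀ b₁ Mstar, DecidableEq (geo9Y x).Site] {c35 : ℝ}
    (T T₁ : ∀ x : MemberY d ℓ hd hL b₀ b₁ Mstar, CfgY 𝔸 x.toKIdx → Module.End ℂ ((geo9Y x).Site → 𝔸))
    (hco : CoerciveUnder c35 (fun x => geoComap (geo9Y x) (Prod.fst : (geo9Y x).Site × Ff → (geo9Y x).Site)) (bg9Y 𝔸 G)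
      (fun x U => normMatY b (lamInvY x.toKIdx) (T x U)))
    (hdec : DecayUnder c35 (fun x => geoComap (geo9Y x) (Prod.fst : (geo9Y x).Site × Ff → (geo9Y x).Site)) (bg9Y 𝔸 G)
      (fun x U => normMatY b (lamInvY x.toKIdx) (T x U)))
    (hco₁ : CoerciveUnder c35 (fun x => geoComap (geo9Y x) (Prod.fst : (geo9Y x).Site × Ff → (geo9Y x).Site)) (bg9Y 𝔸 G)
      (fun x U => normMatY b (lamInvY x.toKIdx) (T₁ x U)))
    (hdec₁ : DecayUnder c35 (fun x => geoComap (geo9Y x) (Prod.fst : (geo9Y x).Site × Ff → (geo9Y x).Site)) (bg9Y 𝔸 G)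
      (fun x U => normMatY b (lamInvY x.toKIdx) (T₁ x U))) :
    B9.Stmt3132Printed dd c35 (geo9Y (d := d) (ℓ := ℓ) (hd := hd) (hL := hL) (b₀ := b₀) (b₁ := b₁) (Mstar := Mstar)) (bg9Y 𝔸 G)
      (fun x => siteKernelOfOpNu x.toKIdx (bg9Y 𝔸 G x) (fun U => U) (nuY dd x.toKIdx) (fun U => Ring.inverse (T x U)))
      (fun x => siteKernelOfOpNu x.toKIdx (bg9Y 𝔸 G x) (fun U => U) (nuY dd x.toKIdx) (fun U => Ring.inverse (T₁ x U))) := by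
  have hF : ∀ (x : MemberY d ℓ hd hL b₀ b₁ Mstar) (y : (geo9Y x).Site),
      (((Finset.univ.filter fun a : (geo9Y x).Site × Ff => a.1 = y).card : ℕ) : ℝ) ≤ (Fintype.card Ff : ℝ) :=
    fun x y => by rw [card_fiber_fst]
  have hνw : ∀ x : MemberY d ℓ hd hL b₀ b₁ Mstar,
      (fun y => nuY dd x.toKIdx y * lamInvY x.toKIdx y) = fun y => (geo9Y x).len y ^ (-(1 + (dd : ℝ) / 2)) :=
    fun x => funext fun y => nuY_mul_lamInvY dd x.toKIdx y
  have hN : ∀ x : MemberY d ℓ hd hL b₀ b₁ Mstar,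
      InvNormalisedIdx (g := geo9Y x)
        (siteKernelOfOpNu x.toKIdx (bg9Y 𝔸 G x) (fun U => U) (nuY dd x.toKIdx) (fun U => Ring.inverse (T x U)))
        (Prod.fst : (geo9Y x).Site × Ff → (geo9Y x).Site)
        (fun U => normMatY b (lamInvY x.toKIdx) (T x U)) (fun y => (geo9Y x).len y ^ (-(1 + (dd : ℝ) / 2))) := fun x => by
    rw [← hνw x]
    exact invNormalisedIdx_nu_of_ringInverse b x.toKIdx (bg9Y 𝔸 G x) (fun U => U)
      (instF := (inferInstance : Fintype (geo9Y x).Site)) (instD := (inferInstance : DecidableEq (geo9Y x).Site)) (T x)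
      (lamInvY_pos x.toKIdx) (fun y => (nuY_pos dd x.toKIdx y).le)
  have hN₁ : ∀ x : MemberY d ℓ hd hL b₀ b₁ Mstar,
      InvNormalisedIdx (g := geo9Y x)
        (siteKernelOfOpNu x.toKIdx (bg9Y 𝔸 G x) (fun U => U) (nuY dd x.toKIdx) (fun U => Ring.inverse (T₁ x U)))
        (Prod.fst : (geo9Y x).Site × Ff → (geo9Y x).Site)
        (fun U => normMatY b (lamInvY x.toKIdx) (T₁ x U)) (fun y => (geo9Y x).len y ^ (-(1 + (dd : ℝ) / 2))) := fun x => by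
    rw [← hνw x]
    exact invNormalisedIdx_nu_of_ringInverse b x.toKIdx (bg9Y 𝔸 G x) (fun U => U)
      (instF := (inferInstance : Fintype (geo9Y x).Site)) (instD := (inferInstance : DecidableEq (geo9Y x).Site)) (T₁ x)
      (lamInvY_pos x.toKIdx) (fun y => (nuY_pos dd x.toKIdx y).le)
  exact stmt3132Printed_geo9Y_of_coercive_decay_idx dd (fun x => (Prod.fst : (geo9Y x).Site × Ff → (geo9Y x).Site)) hF
    hco hdec hco₁ hdec₁ hN hN₁

end Row26


/-! ## §5 The instance variant (`QGQinv ∕ QG1Qinv` read through `ν`) and row 26 at the `ν`-read letters of record -/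

section Instance

variable (𝔸) (G : Subgroup 𝔸ˣ)

/-- ★ **THE OPERATOR LAYER WITH THE `ν`-WEIGHTED (3.132) READINGS** in the two row-26 fields (`dd := D = d + 1`) — every other field `operatorLayerYOfLetters`'s.
[cite: Balaban1985BackgroundPropagators, Thms 3.1–3.15 pp.397–432, (3.132) p.422] -/
def operatorLayerYNu (x : MemberY d ℓ hd hL b₀ b₁ Mstar) (𝔏 : CovLettersY 𝔸 x) (𝔈 : ExpLettersY 𝔸 G x) :
    B9PinCarriersKLevelV1.OperatorLayerY d ℓ hd hL b₀ b₁ Mstar 𝔸 G x :=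
  { operatorLayerYOfLetters 𝔸 G x 𝔏 𝔈 with
    QGQinv := siteKernelOfOpNu x.toKIdx (bg9Y 𝔸 G x) (fun U => U) (nuY (d + 1) x.toKIdx) 𝔏.QGQinv
    QG1Qinv := siteKernelOfOpNu x.toKIdx (bg9Y 𝔸 G x) (fun U => U) (nuY (d + 1) x.toKIdx) 𝔏.QG1Qinv }

variable {𝔸 G}
variable (x : MemberY d ℓ hd hL b₀ b₁ Mstar) (𝔏 : CovLettersY 𝔸 x) (𝔈 : ExpLettersY 𝔸 G x)

/-- the two (3.132) fields ARE the `ν`-readings of the letters; every other field is `operatorLayerYOfLetters`'s (`rfl`).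
[cite: Balaban1985BackgroundPropagators, (3.132) p.422, Thms 3.1–3.15 pp.397–432, bookkeeping] -/
theorem operatorLayerYNu_fields :
    (operatorLayerYNu 𝔸 G x 𝔏 𝔈).QGQinv = siteKernelOfOpNu x.toKIdx (bg9Y 𝔸 G x) (fun U => U) (nuY (d + 1) x.toKIdx) 𝔏.QGQinv ∧
      (operatorLayerYNu 𝔸 G x 𝔏 𝔈).QG1Qinv = siteKernelOfOpNu x.toKIdx (bg9Y 𝔸 G x) (fun U => U) (nuY (d + 1) x.toKIdx) 𝔏.QG1Qinv ∧
      (operatorLayerYNu 𝔸 G x 𝔏 𝔈).Gp = (operatorLayerYOfLetters 𝔸 G x 𝔏 𝔈).Gp ∧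
      (operatorLayerYNu 𝔸 G x 𝔏 𝔈).GA = (operatorLayerYOfLetters 𝔸 G x 𝔏 𝔈).GA ∧
      (operatorLayerYNu 𝔸 G x 𝔏 𝔈).Cinv = (operatorLayerYOfLetters 𝔸 G x 𝔏 𝔈).Cinv ∧
      (operatorLayerYNu 𝔸 G x 𝔏 𝔈).GD = (operatorLayerYOfLetters 𝔸 G x 𝔏 𝔈).GD ∧
      (operatorLayerYNu 𝔸 G x 𝔏 𝔈).G₁ = (operatorLayerYOfLetters 𝔸 G x 𝔏 𝔈).G₁ ∧
      (operatorLayerYNu 𝔸 G x 𝔏 𝔈).H = (operatorLayerYOfLetters 𝔸 G x 𝔏 𝔈).H ∧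
      (operatorLayerYNu 𝔸 G x 𝔏 𝔈).H₁ = (operatorLayerYOfLetters 𝔸 G x 𝔏 𝔈).H₁ ∧
      (operatorLayerYNu 𝔸 G x 𝔏 𝔈).GG = (operatorLayerYOfLetters 𝔸 G x 𝔏 𝔈).GG ∧
      (operatorLayerYNu 𝔸 G x 𝔏 𝔈).Kdiff = (operatorLayerYOfLetters 𝔸 G x 𝔏 𝔈).Kdiff ∧
      (operatorLayerYNu 𝔸 G x 𝔏 𝔈).Ck = (operatorLayerYOfLetters 𝔸 G x 𝔏 𝔈).Ck ∧
      (operatorLayerYNu 𝔸 G x 𝔏 𝔈).P349 = (operatorLayerYOfLetters 𝔸 G x 𝔏 𝔈).P349 ∧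
      (operatorLayerYNu 𝔸 G x 𝔏 𝔈).E37 = (operatorLayerYOfLetters 𝔸 G x 𝔏 𝔈).E37 ∧
      (operatorLayerYNu 𝔸 G x 𝔏 𝔈).EK39 = (operatorLayerYOfLetters 𝔸 G x 𝔏 𝔈).EK39 ∧
      (operatorLayerYNu 𝔸 G x 𝔏 𝔈).E310 = (operatorLayerYOfLetters 𝔸 G x 𝔏 𝔈).E310 :=
  ⟨rfl, rfl, rfl, rfl, rfl, rfl, rfl, rfl, rfl, rfl, rfl, rfl, rfl, rfl, rfl, rfl⟩

end Instance

section RecordNu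

open scoped Matrix.Norms.L2Operator
open B7Prop2SpecialUnitary (specialUnitaryUnits)
open B9Eq3132SectDLetters (QGQY QGQinvY QGQinvY_one_liftEndY)

variable {N : ℕ}

/-- ★ **THE `ν`-READ INSTANCE over a letters family** (def-Y's `opsYOfLetters` with the two row-26 fields re-read). [cite: Balaban1985BackgroundPropagators, (3.132) p.422] -/
def opsYNuOfLetters (N : ℕ) (θ : Stage3Params) (Mstar : ℕ) (𝔏 : LettersY N θ Mstar) (𝔈 : ExpsY N θ Mstar) : OpsY N θ Mstar :=
  fun x => operatorLayerYNu (Matrix (Fin N) (Fin N) ℂ) (specialUnitaryUnits (Fin N)) x (𝔏 x) (𝔈 x)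

/-- member by member the instance is `operatorLayerYNu` (`rfl`). [cite: Balaban1985BackgroundPropagators, (3.132) p.422, bookkeeping] -/
theorem opsYNuOfLetters_apply (θ : Stage3Params) (Mstar : ℕ) (𝔏 : LettersY N θ Mstar) (𝔈 : ExpsY N θ Mstar)
    (x : MemberY θ.d₆ θ.ℓ₆ θ.hd' θ.hL' θ.b₀ θ.b₁ Mstar) :
    opsYNuOfLetters N θ Mstar 𝔏 𝔈 x = operatorLayerYNu (Matrix (Fin N) (Fin N) ℂ) (specialUnitaryUnits (Fin N)) x (𝔏 x) (𝔈 x) := rfl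

end RecordNu

/-! ## §6 The instance-of-record variant: def-Y's `opsYOfRecordV4E` with the two (3.132) fields `ν`-read (for the knit's re-point) -/

section RecordV4E

open scoped Matrix.Norms.L2Operator
open B7Prop2SpecialUnitary (specialUnitaryUnits)
open B9Eq3132SectDLetters (QGQY)
open B9Ineq349SiteReading (operatorLayerYS349)

variable (𝔸) (G : Subgroup 𝔸ˣ)

/-- g6's site-(3.49) layer with the two (3.132) fields `ν`-read. [cite: Balaban1985BackgroundPropagators, (3.49) p.399, (3.132) p.422] -/
def operatorLayerYS349Nu (x : MemberY d ℓ hd hL b₀ b₁ Mstar) (𝔏 : CovLettersY 𝔸 x) (𝔈 : ExpLettersY 𝔸 G x) :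
    B9PinCarriersKLevelV1.OperatorLayerY d ℓ hd hL b₀ b₁ Mstar 𝔸 G x :=
  { operatorLayerYS349 𝔸 G x 𝔏 𝔈 with
    QGQinv := siteKernelOfOpNu x.toKIdx (bg9Y 𝔸 G x) (fun U => U) (nuY (d + 1) x.toKIdx) 𝔏.QGQinv
    QG1Qinv := siteKernelOfOpNu x.toKIdx (bg9Y 𝔸 G x) (fun U => U) (nuY (d + 1) x.toKIdx) 𝔏.QG1Qinv }

variable {𝔸 G} {N : ℕ}

/-- the site-(3.49) + `ν`-(3.132) instance over a letters family. [cite: Balaban1985BackgroundPropagators, (3.49) p.399, (3.132) p.422] -/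
def opsYS349NuOfLetters (N : ℕ) (θ : Stage3Params) (Mstar : ℕ) (𝔏 : LettersY N θ Mstar) (𝔈 : ExpsY N θ Mstar) : OpsY N θ Mstar :=
  fun x => operatorLayerYS349Nu (Matrix (Fin N) (Fin N) ℂ) (specialUnitaryUnits (Fin N)) x (𝔏 x) (𝔈 x)

/-- ★★ **def-Y's v4 INSTANCE OF RECORD WITH ROW 26 REPAIRED**: `opsYSectE … (opsYS349NuOfLetters … (lettersYOfRecordV4 …) 𝔈) (lettersYOfRecordV4 …) 𝔢 𝔴` —
`opsYOfRecordV4E` (p500763) with ONLY `QGQinv ∕ QG1Qinv` re-read through `ν`; every other field is `opsYOfRecordV4E`'s by `rfl` (`opsYNuOfRecordV4E_fields`).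
[cite: Balaban1985BackgroundPropagators, Thms 3.1–3.15 pp.397–432, (3.132) p.422] -/
def opsYNuOfRecordV4E (N : ℕ) (θ : Stage3Params) (Mstar : ℕ) (𝔯 : ResY N θ Mstar) (𝔢 : SectEY N θ Mstar) (𝔴 : RWEY N θ Mstar)
    (𝔈 : ExpsY N θ Mstar) : OpsY N θ Mstar :=
  opsYSectE N θ Mstar (opsYS349NuOfLetters N θ Mstar (lettersYOfRecordV4 N θ Mstar 𝔯) 𝔈) (lettersYOfRecordV4 N θ Mstar 𝔯) 𝔢 𝔴

variable (θ : Stage3Params) (Mstar : ℕ) (𝔯 : ResY N θ Mstar) (𝔢 : SectEY N θ Mstar) (𝔴 : RWEY N θ Mstar) (𝔈 : ExpsY N θ Mstar)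
  (x : MemberY θ.d₆ θ.ℓ₆ θ.hd' θ.hL' θ.b₀ θ.b₁ Mstar)

/-- ★ ROW 26's first kernel at the repaired instance of record IS the `ν`-reading of the genuine `(QGQ*)⁻¹` over the symmetrised transporters.
[cite: Balaban1985BackgroundPropagators, (3.132) p.422, bookkeeping] -/
theorem opsYNuOfRecordV4E_QGQinv :
    (opsYNuOfRecordV4E N θ Mstar 𝔯 𝔢 𝔴 𝔈 x).QGQinv =
      siteKernelOfOpNu x.toKIdx (bg9Y (Matrix (Fin N) (Fin N) ℂ) (specialUnitaryUnits (Fin N)) x) (fun U => U) (nuY (θ.d₆ + 1) x.toKIdx)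
        (B9Eq3132SectDLetters.QGQinvY x.toKIdx (parSymY x.toKIdx) (parBY x.toKIdx) (GpY x.toKIdx (parSymY x.toKIdx))) := rfl

/-- ★ ROW 26's second kernel at the repaired instance of record IS the `ν`-reading of the genuine `(QG₁Q*)⁻¹`.
[cite: Balaban1985BackgroundPropagators, (3.132) p.422, (3.129) p.421, bookkeeping] -/
theorem opsYNuOfRecordV4E_QG1Qinv :
    (opsYNuOfRecordV4E N θ Mstar 𝔯 𝔢 𝔴 𝔈 x).QG1Qinv =
      siteKernelOfOpNu x.toKIdx (bg9Y (Matrix (Fin N) (Fin N) ℂ) (specialUnitaryUnits (Fin N)) x) (fun U => U) (nuY (θ.d₆ + 1) x.toKIdx)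
        (QG1QinvY x.toKIdx (parSymY x.toKIdx) (parBY x.toKIdx) (GpY x.toKIdx (parSymY x.toKIdx)) (𝔯 x).Δ2) := rfl

/-- ★ the OPERATOR-LETTER fields of the repaired instance ARE `opsYOfRecordV4E`'s (rows 4–12, 17, 20–23 transport by `rfl`).
[cite: Balaban1985BackgroundPropagators, Thms 3.1–3.14 pp.397–427, bookkeeping] -/
theorem opsYNuOfRecordV4E_letters :
    (opsYNuOfRecordV4E N θ Mstar 𝔯 𝔢 𝔴 𝔈 x).Gp = (opsYOfRecordV4E N θ Mstar 𝔯 𝔢 𝔴 𝔈 x).Gp ∧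
      (opsYNuOfRecordV4E N θ Mstar 𝔯 𝔢 𝔴 𝔈 x).GA = (opsYOfRecordV4E N θ Mstar 𝔯 𝔢 𝔴 𝔈 x).GA ∧
      (opsYNuOfRecordV4E N θ Mstar 𝔯 𝔢 𝔴 𝔈 x).Cinv = (opsYOfRecordV4E N θ Mstar 𝔯 𝔢 𝔴 𝔈 x).Cinv ∧
      (opsYNuOfRecordV4E N θ Mstar 𝔯 𝔢 𝔴 𝔈 x).GD = (opsYOfRecordV4E N θ Mstar 𝔯 𝔢 𝔴 𝔈 x).GD ∧
      (opsYNuOfRecordV4E N θ Mstar 𝔯 𝔢 𝔴 𝔈 x).G₁ = (opsYOfRecordV4E N θ Mstar 𝔯 𝔢 𝔴 𝔈 x).G₁ ∧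
      (opsYNuOfRecordV4E N θ Mstar 𝔯 𝔢 𝔴 𝔈 x).H = (opsYOfRecordV4E N θ Mstar 𝔯 𝔢 𝔴 𝔈 x).H ∧
      (opsYNuOfRecordV4E N θ Mstar 𝔯 𝔢 𝔴 𝔈 x).H₁ = (opsYOfRecordV4E N θ Mstar 𝔯 𝔢 𝔴 𝔈 x).H₁ ∧
      (opsYNuOfRecordV4E N θ Mstar 𝔯 𝔢 𝔴 𝔈 x).GG = (opsYOfRecordV4E N θ Mstar 𝔯 𝔢 𝔴 𝔈 x).GG ∧
      (opsYNuOfRecordV4E N θ Mstar 𝔯 𝔢 𝔴 𝔈 x).Kdiff = (opsYOfRecordV4E N θ Mstar 𝔯 𝔢 𝔴 𝔈 x).Kdiff :=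
  ⟨rfl, rfl, rfl, rfl, rfl, rfl, rfl, rfl, rfl⟩

/-- ★ the Sect.-E and (3.49) fields of the repaired instance ARE `opsYOfRecordV4E`'s (rows 24–25 transport by `rfl`).
[cite: Balaban1985BackgroundPropagators, Thm 3.15 p.432, (3.49) p.399, bookkeeping] -/
theorem opsYNuOfRecordV4E_sectE :
    (opsYNuOfRecordV4E N θ Mstar 𝔯 𝔢 𝔴 𝔈 x).Ck = (opsYOfRecordV4E N θ Mstar 𝔯 𝔢 𝔴 𝔈 x).Ck ∧
      (opsYNuOfRecordV4E N θ Mstar 𝔯 𝔢 𝔴 𝔈 x).GivenBy3185 = (opsYOfRecordV4E N θ Mstar 𝔯 𝔢 𝔴 𝔈 x).GivenBy3185 ∧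
      (opsYNuOfRecordV4E N θ Mstar 𝔯 𝔢 𝔴 𝔈 x).HasRWExpC = (opsYOfRecordV4E N θ Mstar 𝔯 𝔢 𝔴 𝔈 x).HasRWExpC ∧
      (opsYNuOfRecordV4E N θ Mstar 𝔯 𝔢 𝔴 𝔈 x).P349 = (opsYOfRecordV4E N θ Mstar 𝔯 𝔢 𝔴 𝔈 x).P349 :=
  ⟨rfl, rfl, rfl, rfl⟩

/-- ★ the predicate ∕ expansion fields of the repaired instance ARE `opsYOfRecordV4E`'s (rows 1–3, 13–16, 18–19 transport by `rfl`).
[cite: Balaban1985BackgroundPropagators, Thms 3.4–3.13 pp.400–426, bookkeeping] -/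
theorem opsYNuOfRecordV4E_preds :
    (opsYNuOfRecordV4E N θ Mstar 𝔯 𝔢 𝔴 𝔈 x).IsAnalyticExt = (opsYOfRecordV4E N θ Mstar 𝔯 𝔢 𝔴 𝔈 x).IsAnalyticExt ∧
      (opsYNuOfRecordV4E N θ Mstar 𝔯 𝔢 𝔴 𝔈 x).E37 = (opsYOfRecordV4E N θ Mstar 𝔯 𝔢 𝔴 𝔈 x).E37 ∧
      (opsYNuOfRecordV4E N θ Mstar 𝔯 𝔢 𝔴 𝔈 x).EK39 = (opsYOfRecordV4E N θ Mstar 𝔯 𝔢 𝔴 𝔈 x).EK39 ∧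
      (opsYNuOfRecordV4E N θ Mstar 𝔯 𝔢 𝔴 𝔈 x).E310 = (opsYOfRecordV4E N θ Mstar 𝔯 𝔢 𝔴 𝔈 x).E310 ∧
      (opsYNuOfRecordV4E N θ Mstar 𝔯 𝔢 𝔴 𝔈 x).PosDef = (opsYOfRecordV4E N θ Mstar 𝔯 𝔢 𝔴 𝔈 x).PosDef ∧
      (opsYNuOfRecordV4E N θ Mstar 𝔯 𝔢 𝔴 𝔈 x).HasRWExp = (opsYOfRecordV4E N θ Mstar 𝔯 𝔢 𝔴 𝔈 x).HasRWExp ∧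
      (opsYNuOfRecordV4E N θ Mstar 𝔯 𝔢 𝔴 𝔈 x).HasRWExpH = (opsYOfRecordV4E N θ Mstar 𝔯 𝔢 𝔴 𝔈 x).HasRWExpH ∧
      (opsYNuOfRecordV4E N θ Mstar 𝔯 𝔢 𝔴 𝔈 x).PosDefK = (opsYOfRecordV4E N θ Mstar 𝔯 𝔢 𝔴 𝔈 x).PosDefK :=
  ⟨rfl, rfl, rfl, rfl, rfl, rfl, rfl, rfl⟩

variable {Ff : Type} [Fintype Ff] [DecidableEq Ff]

/-- ★★★ **ROW 26 AT THE REPAIRED INSTANCE OF RECORD `opsYNuOfRecordV4E`** from exactly four Λ-normalised estimate binders (the knit's `s3132` face to display;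
at `U = 1` it is a theorem, `B9Eq3132NuReadingAtOne`). [cite: Balaban1985BackgroundPropagators, (3.132) p.422, Thm 3.12 p.423 (prefix); Balaban1984PropagatorsII, (2.142) (2.147) p.248, Prop. 2.7 (2.149) p.249] -/
theorem s3132Nu_opsYNuOfRecordV4E [NeZero N] {c35 : ℝ}
    [∀ x : MemberY θ.d₆ θ.ℓ₆ θ.hd' θ.hL' θ.b₀ θ.b₁ Mstar, Fintype (geo9Y x).Site]
    [∀ x : MemberY θ.d₆ θ.ℓ₆ θ.hd' θ.hL' θ.b₀ θ.b₁ Mstar, DecidableEq (geo9Y x).Site]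
    (b : Module.Basis Ff ℝ (Matrix (Fin N) (Fin N) ℂ))
    (hco : CoerciveUnder c35
      (fun x : MemberY θ.d₆ θ.ℓ₆ θ.hd' θ.hL' θ.b₀ θ.b₁ Mstar => geoComap (geo9Y x) (Prod.fst : (geo9Y x).Site × Ff → (geo9Y x).Site))
      (bg9Y (Matrix (Fin N) (Fin N) ℂ) (specialUnitaryUnits (Fin N)))
      (fun x U => normMatY b (lamInvY x.toKIdx) (QGQY x.toKIdx (parSymY x.toKIdx) (parBY x.toKIdx) (GpY x.toKIdx (parSymY x.toKIdx)) U)))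
    (hdec : DecayUnder c35
      (fun x : MemberY θ.d₆ θ.ℓ₆ θ.hd' θ.hL' θ.b₀ θ.b₁ Mstar => geoComap (geo9Y x) (Prod.fst : (geo9Y x).Site × Ff → (geo9Y x).Site))
      (bg9Y (Matrix (Fin N) (Fin N) ℂ) (specialUnitaryUnits (Fin N)))
      (fun x U => normMatY b (lamInvY x.toKIdx) (QGQY x.toKIdx (parSymY x.toKIdx) (parBY x.toKIdx) (GpY x.toKIdx (parSymY x.toKIdx)) U)))
    (hco₁ : CoerciveUnder c35
      (fun x : MemberY θ.d₆ θ.ℓ₆ θ.hd' θ.hL' θ.b₀ θ.b₁ Mstar => geoComap (geo9Y x) (Prod.fst : (geo9Y x).Site × Ff → (geo9Y x).Site))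
      (bg9Y (Matrix (Fin N) (Fin N) ℂ) (specialUnitaryUnits (Fin N)))
      (fun x U => normMatY b (lamInvY x.toKIdx) (QGQOfY x.toKIdx (parBY x.toKIdx)
        (G1Y x.toKIdx (parSymY x.toKIdx) (parBY x.toKIdx) (GpY x.toKIdx (parSymY x.toKIdx)) (𝔯 x).Δ2) U)))
    (hdec₁ : DecayUnder c35
      (fun x : MemberY θ.d₆ θ.ℓ₆ θ.hd' θ.hL' θ.b₀ θ.b₁ Mstar => geoComap (geo9Y x) (Prod.fst : (geo9Y x).Site × Ff → (geo9Y x).Site))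
      (bg9Y (Matrix (Fin N) (Fin N) ℂ) (specialUnitaryUnits (Fin N)))
      (fun x U => normMatY b (lamInvY x.toKIdx) (QGQOfY x.toKIdx (parBY x.toKIdx)
        (G1Y x.toKIdx (parSymY x.toKIdx) (parBY x.toKIdx) (GpY x.toKIdx (parSymY x.toKIdx)) (𝔯 x).Δ2) U))) :
    B9.Stmt3132Printed (θ.d₆ + 1) c35 (geo9Y (d := θ.d₆) (ℓ := θ.ℓ₆) (hd := θ.hd') (hL := θ.hL') (b₀ := θ.b₀) (b₁ := θ.b₁) (Mstar := Mstar))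
      (bg9Y (Matrix (Fin N) (Fin N) ℂ) (specialUnitaryUnits (Fin N)))
      (fun x => (opsYNuOfRecordV4E N θ Mstar 𝔯 𝔢 𝔴 𝔈 x).QGQinv) (fun x => (opsYNuOfRecordV4E N θ Mstar 𝔯 𝔢 𝔴 𝔈 x).QG1Qinv) :=
  stmt3132Printed_nu_of_coercive_decay (specialUnitaryUnits (Fin N)) b (θ.d₆ + 1)
    (fun x U => QGQY x.toKIdx (parSymY x.toKIdx) (parBY x.toKIdx) (GpY x.toKIdx (parSymY x.toKIdx)) U)
    (fun x U => QGQOfY x.toKIdx (parBY x.toKIdx) (G1Y x.toKIdx (parSymY x.toKIdx) (parBY x.toKIdx) (GpY x.toKIdx (parSymY x.toKIdx)) (𝔯 x).Δ2) U)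
    hco hdec hco₁ hdec₁

end RecordV4E

end

end Literature.MathematicalPhysics.QuantumFieldTheory.Balaban1983to89.B9Eq3132NuReading
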